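import Mathlib
import HarnessLib
import Summits.NavierStokesRegularity.NavierStokesRegularity.Theorems.PoloidalWindowDoorLrcModEntireJetCertRelabel

/-!
# Route `PoloidalWindowDoor`, item `LrcModEntire` (stmt-NavierStokesRegularity-20428) — certificate checker: POINT-ZERO («gauge») LETTERS
# (values that vanish AT THE BASE POINT only, e.g. the Galilean rest frame `u(p₀) = 0` of the registered stub)

Cell ns-regularity-ideate, seat ns-poloidal-K2-p3 gen 8 (LEAD of item 20428; `--supports stmt-NavierStokesRegularity-20428`; definitions reviewed).  Generic, no
Navier–Stokes content.  Every exact-elimination engine on the (TH) column works in the GALILEAN GAUGE `u(p₀) = 0` (cert-1 B/s3: `w₀₀ = f₁₀ = f₀₁ = 0`; the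
registered statement `stub_localTHEmptyHypNUG` carries `u p₀.1 p₀.2 = 0` by name, p586459): a hypothesis that holds AT the base point, not on the open set, so
it is neither a law (cannot be differentiated) nor a pin.  Its sound use in a certificate is at the LEAF ONLY: a derived law `L` (vanishing on `U`) closes the
goal if `L − pins^e` is a sum of monomials each containing a letter that vanishes at `p₀` — then `pins^e(p₀) = L(p₀) = 0`, contradiction.  (Not compatible
with `split` nodes, which move the base point: gauged certificates are chunks + one leaf, i.e. Gröbner-style `pins^N ∈ I`.)

* `allZeroDiv zs p` — every term of `p` has a positive exponent at some index of `zs` (Boolean); `ev_eq_zero_of_allZeroDiv`;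
* `LocalDatumZ n S M v hyps pins zs` — a `LocalDatum` whose jet map moreover VANISHES AT `p₀` in the coordinates `zs`; `LocalDatumZ.toLocalDatum`,
  `LocalDatumZ.extendS` (chunking), `LocalDatumZ.false_of_leaf` with the Boolean `leafCheckZ` (derive, then `L_k − pins^e` gauge-divisible);
* `LocalDatumZ.relabel` — the relabeling of `…JetCertRelabel` carries point-zero letters: new zero letters are those new letters `T a` all of whose monomials
  contain an old zero letter (`zerosCheck`).

WHAT THIS IS NOT: not a claim about Navier–Stokes and not a certificate. [folklore]
-/

noncomputable section

-- the summit and its single sub-problem share the name (CONVENTIONS §1), as in every Theorems file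
set_option linter.dupNamespace false

namespace Summit.NavierStokesRegularity.NavierStokesRegularity.Theorems.PoloidalWindowDoorLrcModEntireJetCertGauge

open _root_.Topology _root_.Filter Set
open Literature.Analysis.ValidatedNumerics Literature.Analysis.ValidatedNumerics.QMvPoly
open Literature.Analysis.Calculus.MvPoly
open Summit.NavierStokesRegularity.NavierStokesRegularity.Theorems.PoloidalWindowDoorLrcModEntireJetCertDefs
open Summit.NavierStokesRegularity.NavierStokesRegularity.Theorems.PoloidalWindowDoorLrcModEntireJetCertMasked
open Summit.NavierStokesRegularity.NavierStokesRegularity.Theorems.PoloidalWindowDoorLrcModEntireJetCertTree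
open Summit.NavierStokesRegularity.NavierStokesRegularity.Theorems.PoloidalWindowDoorLrcModEntireJetCertFast2
open Summit.NavierStokesRegularity.NavierStokesRegularity.Theorems.PoloidalWindowDoorLrcModEntireJetCertRelabel
open Summit.NavierStokesRegularity.NavierStokesRegularity.Theorems.PoloidalWindowDoorLrcModEntireJetLetters

variable {E : Type*} [NormedAddCommGroup E] [NormedSpace ℝ E] {n : ℕ}

/-! ### Polynomials divisible term-wise by point-zero letters -/

/-- «every term of `p` has a positive exponent at some index `< n` of `zs`» (Boolean). [folklore] -/
def allZeroDiv (n : ℕ) (zs : List ℕ) (p : QMvPoly) : Bool :=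
  p.all fun t => zs.any fun i => decide (i < n) && decide (0 < t.1.getD i 0)

/-- Such a polynomial vanishes at every point whose `zs`-coordinates vanish. [folklore] -/
theorem ev_eq_zero_of_allZeroDiv {zs : List ℕ} {z : EuclideanSpace ℝ (Fin n)} (hz : ∀ i ∈ zs, ∀ hi : i < n, z ⟨i, hi⟩ = 0) :
    ∀ p : QMvPoly, allZeroDiv n zs p = true → ev n p z = 0 := by
  intro p
  induction p with
  | nil => intro; simp
  | cons t q ih =>
    intro h
    simp only [allZeroDiv, List.all_cons, Bool.and_eq_true, List.any_eq_true, decide_eq_true_eq] at h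
    obtain ⟨⟨i, hi, hin, hpos⟩, hq⟩ := h
    have hq' : allZeroDiv n zs q = true := by simpa [allZeroDiv] using hq
    rw [ev, toFun_apply, QMvPoly.eval_toMv_cons, ← toFun_apply, ← ev, ih hq']
    have hfac : (∏ j : Fin n, z j ^ t.1.getD j 0) = 0 := by
      apply Finset.prod_eq_zero (Finset.mem_univ (⟨i, hin⟩ : Fin n))
      rw [hz i hi hin]
      exact zero_pow (Nat.pos_iff_ne_zero.1 hpos)
    rw [hfac]; simp

/-! ### Local data with point-zero letters -/

/-- **A LOCAL DATUM WITH POINT-ZERO LETTERS**: a `LocalDatum` whose jet map vanishes AT the base point in the coordinates `zs`. [folklore] -/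
def LocalDatumZ (n : ℕ) (S : ℕ → ℕ → QMvPoly) (M : ℕ → ℕ → Bool) (v : ℕ → E) (hyps pins : List QMvPoly) (zs : List ℕ) : Prop :=
  ∃ (U : Set E) (p₀ : E) (g : E → EuclideanSpace ℝ (Fin n)), IsOpen U ∧ p₀ ∈ U ∧ (∀ x ∈ U, DifferentiableAt ℝ g x) ∧
    (∀ j, ∀ i : Fin n, M j i = true → ∀ x ∈ U, fderiv ℝ (fun y => g y i) x (v j) = ev n (S j i) (g x)) ∧
    (∀ L ∈ hyps, ∀ x ∈ U, ev n L (g x) = 0) ∧ (∀ π ∈ pins, ev n π (g p₀) ≠ 0) ∧ (∀ i ∈ zs, ∀ hi : i < n, g p₀ ⟨i, hi⟩ = 0)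

/-- Forgetting the point-zero letters. [folklore] -/
theorem LocalDatumZ.toLocalDatum {S : ℕ → ℕ → QMvPoly} {M : ℕ → ℕ → Bool} {v : ℕ → E} {hyps pins : List QMvPoly} {zs : List ℕ}
    (h : LocalDatumZ (E := E) n S M v hyps pins zs) : LocalDatum (E := E) n S M v hyps pins := by
  obtain ⟨U, p₀, g, hU, hp₀, hg, hS, hh, hp, _⟩ := h
  exact ⟨U, p₀, g, hU, hp₀, hg, hS, hh, hp⟩

/-- **CHUNKING** with point-zero letters: a certified law joins the hypotheses. [folklore] -/
theorem LocalDatumZ.extendS {S : ℕ → ℕ → QMvPoly} {M : ℕ → ℕ → Bool} {v : ℕ → E} {hyps pins : List QMvPoly} {zs : List ℕ}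
    (hdat : LocalDatumZ (E := E) n S M v hyps pins zs) {cert : List (List (QMvPoly × ℕ × List ℕ))} {k : ℕ} {T : QMvPoly}
    (hcheck : certCheckS n S M hyps cert k T = true) : LocalDatumZ (E := E) n S M v (hyps ++ [T]) pins zs := by
  obtain ⟨U, p₀, g, hU, hp₀, hg, hS, hhyps, hpins, hz⟩ := hdat
  refine ⟨U, p₀, g, hU, hp₀, hg, hS, ?_, hpins, hz⟩
  intro L hL x hx
  rcases List.mem_append.1 hL with h | h
  · exact hhyps L h x hx
  · rw [List.mem_singleton.1 h]; exact ev_eq_zero_of_certCheckS hU hg hS hhyps hcheck x hx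

/-- **THE GAUGED LEAF CHECK**: derive the laws of `steps` from `hyps`; the `k`-th law minus the pin monomial `pins^e` must be term-wise divisible by the
point-zero letters `zs` (Boolean). [folklore] -/
def leafCheckZ (n : ℕ) (S : ℕ → ℕ → QMvPoly) (M : ℕ → ℕ → Bool) (hyps pins : List QMvPoly) (zs : List ℕ)
    (steps : List (List (QMvPoly × ℕ × List ℕ))) (k : ℕ) (e : List ℕ) : Bool :=
  match deriveS n S M hyps steps with
  | none => false
  | some laws => allZeroDiv n zs (normalizeS (laws.getD k [] ++ QMvPoly.smul (-1) (pinProduct pins e)))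

/-- **SOUNDNESS OF THE GAUGED LEAF**: a datum with point-zero letters is refuted by a derivation whose `k`-th law equals a pin monomial up to terms
vanishing at the base point. [folklore] -/
theorem LocalDatumZ.false_of_leaf {S : ℕ → ℕ → QMvPoly} {M : ℕ → ℕ → Bool} {v : ℕ → E} {hyps pins : List QMvPoly} {zs : List ℕ}
    (hdat : LocalDatumZ (E := E) n S M v hyps pins zs) {steps : List (List (QMvPoly × ℕ × List ℕ))} {k : ℕ} {e : List ℕ}
    (hcheck : leafCheckZ n S M hyps pins zs steps k e = true) : False := by
  obtain ⟨U, p₀, g, hU, hp₀, hg, hS, hhyps, hpins, hz⟩ := hdat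
  simp only [leafCheckZ] at hcheck
  cases hd : deriveS n S M hyps steps with
  | none => simp [hd] at hcheck
  | some laws =>
    simp only [hd] at hcheck
    have hlaw : ev n (laws.getD k []) (g p₀) = 0 := by
      rw [List.getD_eq_getElem?_getD]
      cases h : laws[k]? with
      | none => simp
      | some L => simpa using ev_deriveS_eq_zero hU hg hS steps hyps hhyps laws hd L (List.mem_of_getElem? h) p₀ hp₀
    have h0 := ev_eq_zero_of_allZeroDiv (z := g p₀) hz _ hcheck
    rw [ev_normalizeS, ev_append, ev_smul, hlaw] at h0
    have hπ : ev n (pinProduct pins e) (g p₀) = 0 := by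
      have : ((-1 : ℚ) : ℝ) * ev n (pinProduct pins e) (g p₀) = 0 := by simpa using h0
      simpa using this
    exact ev_pinProduct_ne_zero (g p₀) pins e hpins hπ

/-! ### Relabeling with point-zero letters -/

/-- New point-zero letters: each listed new letter `a < m` has `T a` term-wise divisible by the old point-zero letters (Boolean). [folklore] -/
def zerosCheck (n : ℕ) (R : RelabelData) (zs zs' : List ℕ) : Bool :=
  zs'.all fun a => decide (a < R.m) && allZeroDiv n zs (R.Tf a)

/-- **RELABELING A LOCAL DATUM WITH POINT-ZERO LETTERS** (same construction as `…JetCertRelabel.LocalDatum.relabel`). [folklore] -/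
theorem LocalDatumZ.relabel {S : ℕ → ℕ → QMvPoly} {M : ℕ → ℕ → Bool} {v : ℕ → E} {hyps pins : List QMvPoly} {zs : List ℕ} (R : RelabelData)
    (zs' : List ℕ) (hc : relabelCheck n S M hyps pins R = true) (hzc : zerosCheck n R zs zs' = true)
    (hdat : LocalDatumZ (E := E) n S M v hyps pins zs) : LocalDatumZ (E := E) R.m R.Sf R.Mf v R.hyps' R.pins' zs' := by
  obtain ⟨U, p₀, g, hU, hp₀, hg, hS, hhyps, hpins, hz⟩ := hdat
  simp only [relabelCheck, Bool.and_eq_true, List.all_eq_true, List.mem_range, Bool.or_eq_true, Bool.not_eq_true',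
    decide_eq_true_eq] at hc
  obtain ⟨⟨htab, hhyp⟩, hlen, hpin⟩ := hc
  set g' : E → EuclideanSpace ℝ (Fin R.m) := fun x => subPoint R.m R.Tf (g x) with hg'
  have hcoord : ∀ (a : Fin R.m) (x : E), g' x a = ev n (R.Tf a) (g x) := fun a x => by simp [hg']
  have hdiffc : ∀ (p : QMvPoly) (x : E), x ∈ U → DifferentiableAt ℝ (fun y => ev n p (g y)) x := fun p x hx =>
    ((differentiable_toFun (QMvPoly.toMv ℝ n p)) _).comp x (hg x hx)
  have hg'd : ∀ x ∈ U, DifferentiableAt ℝ g' x := fun x hx => by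
    rw [hg']
    exact differentiableAt_mkJet fun a => hdiffc _ x hx
  refine ⟨U, p₀, g', hU, hp₀, hg'd, ?_, ?_, ?_, ?_⟩
  · intro j a hM x hx
    have hj : j < R.M'.length := by
      by_contra hj'
      have : R.Mf j a = false := by
        simp [RelabelData.Mf, List.getD_eq_getElem?_getD, List.getElem?_eq_none (not_lt.1 hj')]
      rw [this] at hM; exact Bool.false_ne_true hM
    have h := htab j hj a a.isLt
    rcases h with h | ⟨huse, hcert⟩
    · rw [h] at hM; exact (Bool.false_ne_true hM).elim
    have hfun : (fun y => g' y a) = fun y => ev n (R.Tf a) (g y) := funext fun y => hcoord a y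
    rw [hfun, fderiv_ev_eq_ev_tderiv_masked (hg x hx) (fun i hi => hS j i hi x hx) huse]
    have h0 := ev_eq_zero_of_certCheckS hU hg (hS) hhyps hcert x hx
    rw [ev_subQ, sub_eq_zero] at h0
    rw [h0, ev_compQ]
  · intro L hL x hx
    obtain ⟨i, hi, rfl⟩ := List.getElem_of_mem hL
    have h := hhyp i hi
    have h0 := ev_eq_zero_of_certCheckS hU hg hS hhyps h x hx
    rw [List.getD_eq_getElem?_getD, List.getElem?_eq_getElem hi, Option.getD_some, ev_compQ] at h0
    simpa [hg'] using h0
  · intro π hπ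
    obtain ⟨i, hi, rfl⟩ := List.getElem_of_mem hπ
    have h := hpin i hi
    have h0 := ev_eq_zero_of_certCheckS hU hg hS hhyps h p₀ hp₀
    rw [ev_subQ, sub_eq_zero, List.getD_eq_getElem?_getD, List.getElem?_eq_getElem hi, Option.getD_some, ev_compQ] at h0
    show ev R.m (R.pins'[i]) (subPoint R.m R.Tf (g p₀)) ≠ 0
    rw [h0]
    exact ev_pinProduct_ne_zero (g p₀) pins _ hpins
  · intro a ha ham
    simp only [zerosCheck, List.all_eq_true, Bool.and_eq_true, decide_eq_true_eq] at hzc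
    obtain ⟨_, hdiv⟩ := hzc a ha
    show g' p₀ ⟨a, ham⟩ = 0
    rw [hcoord ⟨a, ham⟩ p₀]
    exact ev_eq_zero_of_allZeroDiv hz _ hdiv

/-! ### Self-test -/

/-- `X₀²X₁ − 3X₂X₀` is term-wise divisible by `{X₀}` but not by `{X₁}` (decidable). [folklore] -/
theorem allZeroDiv_selfTest :
    allZeroDiv 3 [0] [([2, 1, 0], 1), ([1, 0, 1], -3)] = true ∧ allZeroDiv 3 [1] [([2, 1, 0], 1), ([1, 0, 1], -3)] = false := by
  decide

end Summit.NavierStokesRegularity.NavierStokesRegularity.Theorems.PoloidalWindowDoorLrcModEntireJetCertGauge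

end
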